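import Mathlib
import Summits.Ventures.PercRepro2.Independence
import Summits.Ventures.PercRepro2.Harris
import Summits.Ventures.PercRepro2.HCov
import Summits.Ventures.PercRepro2.CutVertexPaths
import Summits.Ventures.PercRepro2.CutOneFarConn
import Summits.Ventures.PercRepro2.CutTwoFarConn
import Summits.Ventures.PercRepro2.CutTwoFarLaw
import Summits.Ventures.PercRepro2.CutTwoFar
import Summits.Ventures.PercRepro2.CutTwoFarHarris
import Summits.Ventures.PercRepro2.CutTwoFarRootsLaw
import Summits.Ventures.PercRepro2.CutTwoFarRightPat
import Summits.Ventures.PercRepro2.BHKAvoid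
import Summits.Ventures.PercRepro2.BHKEvents
import Summits.Ventures.PercRepro2.CutTwoFarRBConn
import Summits.Ventures.PercRepro2.CutTwoFarRBMasses
import Summits.Ventures.PercRepro2.CutTwoFarRB
import Summits.Ventures.PercRepro2.CutTwoFarRBSigns
import Summits.Ventures.PercRepro2.CutTwoFarRBFull

/-!
# A root and `b` behind a cut vertex, VI: THE CLASS THEOREM (blind cell PercRepro2, typer-1 g50)

The last two endpoint numbers of the T7 reduction are nonnegative (MINE2-CUTVERTEX §13.8, «two
more endpoint theorems by the functional BHK»), here by the EVENT forms: BHK06 Thm 1.3 across the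
clusters `C(a₂)` and `C(v)` with the avoidance of `{v, a₃}` (`bhk_cross_cluster_avoid`, `s = a₂`,
`t = v`, `𝓤 = {o ∈ ·}`, `𝓥 = {a₃ ∈ ·}`: `X₁ · A ≤ X₂ · X₃`, `cross_avoid`) and BHK06 Thm 1.3 in the
same cluster `C(a₂)` given `a₃ ∉ C(a₂)` (`bhk_same_cluster_events`, already `bhk_o_v_avoid3`):
`h(1) = 2 b_v [P(Q′,3∉U′,oL) P(Q′,3L) + D′ P(Q′,3∉U′,oL) + D′ α + (X₂X₃ − X₁A)] ≥ 0` (`h1_rb_nonneg`;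
the regrouping is an identity in the right atoms), and `h(0) = 2 b_v [n₃ (P(Q′,oL,3∉U′) + α) +
(n₃ₒ X₃ − n₃ X₁)] ≥ 0` with `n₃ X₁ ≤ n₃ₒ X₃` from the two BHK steps and a division by `A = P(R_{v,a₃})`
(`h0_rb_nonneg`).  Hence **`HCov_a1bFar`**: (HCOV) holds unconditionally on the class `{a₁, b}` of
S3.5 (a root and `b` behind a cut vertex; the mirror `{a₂, b}` by the root symmetry) — the SIXTH
two-far-mark class in the kernel.  Own work; standard axioms.
-/

namespace Summit.Ventures.PercRepro2

open CovForm CutVertexM9 UnionCluster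

namespace CutTwoFar

section RBClass

variable {V : Type*} {E : Type*} [Fintype E] [DecidableEq E] {R : Type*} [Field R]
variable {ends : E → Sym2 V} {side : E → Bool} {L : Set V} {v : V} {Rt : Set V}

variable (h : CutVertex ends side L v Rt) {o b a₁ a₂ a₃ : V} (p : E → R)
include h

/-- A quantity of the BHK steps, in the right atoms: `cx_X1`. -/
theorem cx_X1 [DecidableEq V] (h2 : a₂ ∈ Rt ∨ a₂ = v) (h3 : a₃ ∈ Rt ∨ a₃ = v) (ho : o ∈ Rt ∨ o = v) : prob p (clusterInEvent ends a₂ {W : Set V | o ∈ W} ∩ clusterInEvent ends v {W : Set V | a₃ ∈ W} ∩ avoidAll ends a₂ {v, a₃}) =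
    ratom ends side v a₂ a₃ o p ![false, true, false, false, true, false] := by
  rw [prob_R6 ends side v a₂ a₃ o p ((clusterInEvent ends a₂ {W : Set V | o ∈ W} ∩ clusterInEvent ends v {W : Set V | a₃ ∈ W} ∩ avoidAll ends a₂ {v, a₃}))
      (fun ρ => ((ρ 4 = true ∧ ρ 1 = true) ∧ (¬ (ρ 0 = true) ∧ ¬ (ρ 3 = true)))) (fun ω => by simp only [Set.mem_inter_iff, clusterInEvent, Set.mem_setOf_eq, mem_cluster, avoidAll, Finset.mem_insert, Finset.mem_singleton, forall_eq_or_imp, forall_eq, rb_conn_a₂_o h h2 ho ω (a₃ := a₃), rb_conn_v_a₃' h h3 ω (a₂ := a₂) (o := o), rb_conn_a₂_v h h2 ω (a₃ := a₃) (o := o), rb_conn_a₂_a₃ h h2 h3 ω (o := o)])]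
  simp only [sum_ite_ratom_eq_sum_transSix, sum_transSix]
  conv_lhs => simp [Fintype.sum_prod_type]

/-- A quantity of the BHK steps, in the right atoms: `cx_A`. -/
theorem cx_A [DecidableEq V] (h2 : a₂ ∈ Rt ∨ a₂ = v) (h3 : a₃ ∈ Rt ∨ a₃ = v) : prob p (avoidAll ends a₂ {v, a₃}) =
    ratom ends side v a₂ a₃ o p ![false, true, true, false, false, true] + ratom ends side v a₂ a₃ o p ![false, true, false, false, true, false] + ratom ends side v a₂ a₃ o p ![false, true, false, false, false, false] + ratom ends side v a₂ a₃ o p ![false, false, true, false, false, false] + ratom ends side v a₂ a₃ o p ![false, false, false, false, true, false] + ratom ends side v a₂ a₃ o p ![false, false, false, false, false, true] + ratom ends side v a₂ a₃ o p ![false, false, false, false, false, false] := by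
  rw [prob_R6 ends side v a₂ a₃ o p ((avoidAll ends a₂ {v, a₃}))
      (fun ρ => (¬ (ρ 0 = true) ∧ ¬ (ρ 3 = true))) (fun ω => by simp only [avoidAll, Set.mem_setOf_eq, Finset.mem_insert, Finset.mem_singleton, forall_eq_or_imp, forall_eq, rb_conn_a₂_v h h2 ω (a₃ := a₃) (o := o), rb_conn_a₂_a₃ h h2 h3 ω (o := o)])]
  simp only [sum_ite_ratom_eq_sum_transSix, sum_transSix]
  conv_lhs => simp [Fintype.sum_prod_type]

/-- A quantity of the BHK steps, in the right atoms: `cx_X2`. -/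
theorem cx_X2 [DecidableEq V] (h2 : a₂ ∈ Rt ∨ a₂ = v) (h3 : a₃ ∈ Rt ∨ a₃ = v) (ho : o ∈ Rt ∨ o = v) : prob p (clusterInEvent ends a₂ {W : Set V | o ∈ W} ∩ avoidAll ends a₂ {v, a₃}) =
    ratom ends side v a₂ a₃ o p ![false, true, false, false, true, false] + ratom ends side v a₂ a₃ o p ![false, false, false, false, true, false] := by
  rw [prob_R6 ends side v a₂ a₃ o p ((clusterInEvent ends a₂ {W : Set V | o ∈ W} ∩ avoidAll ends a₂ {v, a₃}))
      (fun ρ => (ρ 4 = true ∧ (¬ (ρ 0 = true) ∧ ¬ (ρ 3 = true)))) (fun ω => by simp only [Set.mem_inter_iff, clusterInEvent, Set.mem_setOf_eq, mem_cluster, avoidAll, Finset.mem_insert, Finset.mem_singleton, forall_eq_or_imp, forall_eq, rb_conn_a₂_o h h2 ho ω (a₃ := a₃), rb_conn_a₂_v h h2 ω (a₃ := a₃) (o := o), rb_conn_a₂_a₃ h h2 h3 ω (o := o)])]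
  simp only [sum_ite_ratom_eq_sum_transSix, sum_transSix]
  conv_lhs => simp [Fintype.sum_prod_type]

/-- A quantity of the BHK steps, in the right atoms: `cx_X3`. -/
theorem cx_X3 [DecidableEq V] (h2 : a₂ ∈ Rt ∨ a₂ = v) (h3 : a₃ ∈ Rt ∨ a₃ = v) : prob p (clusterInEvent ends v {W : Set V | a₃ ∈ W} ∩ avoidAll ends a₂ {v, a₃}) =
    ratom ends side v a₂ a₃ o p ![false, true, true, false, false, true] + ratom ends side v a₂ a₃ o p ![false, true, false, false, true, false] + ratom ends side v a₂ a₃ o p ![false, true, false, false, false, false] := by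
  rw [prob_R6 ends side v a₂ a₃ o p ((clusterInEvent ends v {W : Set V | a₃ ∈ W} ∩ avoidAll ends a₂ {v, a₃}))
      (fun ρ => (ρ 1 = true ∧ (¬ (ρ 0 = true) ∧ ¬ (ρ 3 = true)))) (fun ω => by simp only [Set.mem_inter_iff, clusterInEvent, Set.mem_setOf_eq, mem_cluster, avoidAll, Finset.mem_insert, Finset.mem_singleton, forall_eq_or_imp, forall_eq, rb_conn_v_a₃' h h3 ω (a₂ := a₂) (o := o), rb_conn_a₂_v h h2 ω (a₃ := a₃) (o := o), rb_conn_a₂_a₃ h h2 h3 ω (o := o)])]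
  simp only [sum_ite_ratom_eq_sum_transSix, sum_transSix]
  conv_lhs => simp [Fintype.sum_prod_type]

/-- A quantity of the BHK steps, in the right atoms: `sc_x3`. -/
theorem sc_x3 (h2 : a₂ ∈ Rt ∨ a₂ = v) (h3 : a₃ ∈ Rt ∨ a₃ = v) : prob p {ω | Conn ends ω v a₂ ∧ ¬ Conn ends ω a₃ a₂} =
    ratom ends side v a₂ a₃ o p ![true, false, true, false, true, false] + ratom ends side v a₂ a₃ o p ![true, false, false, false, false, true] + ratom ends side v a₂ a₃ o p ![true, false, false, false, false, false] := by
  rw [prob_R6 ends side v a₂ a₃ o p ({ω | Conn ends ω v a₂ ∧ ¬ Conn ends ω a₃ a₂})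
      (fun ρ => (ρ 0 = true ∧ ¬ (ρ 3 = true))) (fun ω => by simp only [Set.mem_setOf_eq, rb_conn_v_a₂ h h2 ω (a₃ := a₃) (o := o), rb_conn_a₃_a₂ h h2 h3 ω (o := o)])]
  simp only [sum_ite_ratom_eq_sum_transSix, sum_transSix]
  conv_lhs => simp [Fintype.sum_prod_type]

/-- A quantity of the BHK steps, in the right atoms: `sc_ox3`. -/
theorem sc_ox3 (h2 : a₂ ∈ Rt ∨ a₂ = v) (h3 : a₃ ∈ Rt ∨ a₃ = v) (ho : o ∈ Rt ∨ o = v) : prob p {ω | Conn ends ω o a₂ ∧ Conn ends ω v a₂ ∧ ¬ Conn ends ω a₃ a₂} =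
    ratom ends side v a₂ a₃ o p ![true, false, true, false, true, false] := by
  rw [prob_R6 ends side v a₂ a₃ o p ({ω | Conn ends ω o a₂ ∧ Conn ends ω v a₂ ∧ ¬ Conn ends ω a₃ a₂})
      (fun ρ => (ρ 4 = true ∧ ρ 0 = true ∧ ¬ (ρ 3 = true))) (fun ω => by simp only [Set.mem_setOf_eq, rb_conn_o_a₂ h h2 ho ω (a₃ := a₃), rb_conn_v_a₂ h h2 ω (a₃ := a₃) (o := o), rb_conn_a₃_a₂ h h2 h3 ω (o := o)])]
  simp only [sum_ite_ratom_eq_sum_transSix, sum_transSix]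
  conv_lhs => simp [Fintype.sum_prod_type]

omit h in
/-- **BHK06 1.3 across `C(a₂)` and `C(v)` with the avoidance of `{v, a₃}`**: `X₁ · A ≤ X₂ · X₃`. -/
theorem cross_avoid [Fintype V] [DecidableEq V] [LinearOrder R] [IsStrictOrderedRing R]
    (hp : IsProbVec p) :
    prob p (clusterInEvent ends a₂ {W : Set V | o ∈ W} ∩ clusterInEvent ends v {W : Set V | a₃ ∈ W} ∩
        avoidAll ends a₂ {v, a₃}) * prob p (avoidAll ends a₂ {v, a₃}) ≤
      prob p (clusterInEvent ends a₂ {W : Set V | o ∈ W} ∩ avoidAll ends a₂ {v, a₃}) *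
        prob p (clusterInEvent ends v {W : Set V | a₃ ∈ W} ∩ avoidAll ends a₂ {v, a₃}) :=
  bhk_cross_cluster_avoid p hp ends a₂ v (X := {v, a₃}) (by simp) (fun _ _ hST hW => hST hW)
    (fun _ _ hST hW => hST hW)

/-- **`h(1) ≥ 0`** for the T7 reduction. -/
theorem h1_rb_nonneg [Fintype V] [DecidableEq V] [LinearOrder R] [IsStrictOrderedRing R]
    (h2 : a₂ ∈ Rt ∨ a₂ = v) (h3 : a₃ ∈ Rt ∨ a₃ = v) (ho : o ∈ Rt ∨ o = v) (hp : IsProbVec p) :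
    0 ≤ 2 * prob p {ω | Conn ends ω v a₂} * (prob p {ω | ¬ Conn ends ω v a₂ ∧ ¬ (Conn ends ω a₃ v ∨ Conn ends ω a₃ a₂) ∧ (Conn ends ω o v ∨ Conn ends ω o a₂)} * prob p {ω | ¬ Conn ends ω v a₂ ∧ ¬ Conn ends ω a₃ a₂} + prob p {ω | ¬ Conn ends ω v a₂ ∧ ¬ (Conn ends ω a₃ v ∨ Conn ends ω a₃ a₂)} * (prob p {ω | ¬ Conn ends ω v a₂ ∧ Conn ends ω o v ∧ Conn ends ω a₃ a₂} - prob p {ω | ¬ Conn ends ω v a₂ ∧ Conn ends ω o a₂ ∧ ¬ Conn ends ω a₃ a₂})) := by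
  have hX := cross_avoid p hp (ends := ends) (v := v) (a₂ := a₂) (a₃ := a₃) (o := o)
  -- the regrouping, an identity in the atoms
  have hid : 2 * prob p {ω | Conn ends ω v a₂} * (prob p {ω | ¬ Conn ends ω v a₂ ∧ ¬ (Conn ends ω a₃ v ∨ Conn ends ω a₃ a₂) ∧ (Conn ends ω o v ∨ Conn ends ω o a₂)} * prob p {ω | ¬ Conn ends ω v a₂ ∧ ¬ Conn ends ω a₃ a₂} + prob p {ω | ¬ Conn ends ω v a₂ ∧ ¬ (Conn ends ω a₃ v ∨ Conn ends ω a₃ a₂)} * (prob p {ω | ¬ Conn ends ω v a₂ ∧ Conn ends ω o v ∧ Conn ends ω a₃ a₂} - prob p {ω | ¬ Conn ends ω v a₂ ∧ Conn ends ω o a₂ ∧ ¬ Conn ends ω a₃ a₂})) = 2 * prob p {ω | Conn ends ω v a₂} * (prob p {ω | ¬ Conn ends ω v a₂ ∧ Conn ends ω o v ∧ ¬ (Conn ends ω a₃ v ∨ Conn ends ω a₃ a₂)} * prob p {ω | ¬ Conn ends ω v a₂ ∧ Conn ends ω a₃ v} + prob p {ω | ¬ Conn ends ω v a₂ ∧ ¬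 (Conn ends ω a₃ v ∨ Conn ends ω a₃ a₂)} * prob p {ω | ¬ Conn ends ω v a₂ ∧ Conn ends ω o v ∧ ¬ (Conn ends ω a₃ v ∨ Conn ends ω a₃ a₂)} +
      prob p {ω | ¬ Conn ends ω v a₂ ∧ ¬ (Conn ends ω a₃ v ∨ Conn ends ω a₃ a₂)} * prob p {ω | ¬ Conn ends ω v a₂ ∧ Conn ends ω o v ∧ Conn ends ω a₃ a₂} +
      (prob p (clusterInEvent ends a₂ {W : Set V | o ∈ W} ∩ avoidAll ends a₂ {v, a₃}) *
        prob p (clusterInEvent ends v {W : Set V | a₃ ∈ W} ∩ avoidAll ends a₂ {v, a₃}) -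
       prob p (clusterInEvent ends a₂ {W : Set V | o ∈ W} ∩ clusterInEvent ends v {W : Set V | a₃ ∈ W} ∩
        avoidAll ends a₂ {v, a₃}) * prob p (avoidAll ends a₂ {v, a₃}))) := by
    have hr := ratom_sum_transSix ends side v a₂ a₃ o p
    rw [sum_transSix] at hr
    have hrs : ratom ends side v a₂ a₃ o p ![false, false, false, false, false, false] = 1 - (ratom ends side v a₂ a₃ o p ![true, true, true, true, true, true] + ratom ends side v a₂ a₃ o p ![true, true, false, true, false, false] + ratom ends side v a₂ a₃ o p ![true, false, true, false, true, false] + ratom ends side v a₂ a₃ o p ![true, false, false, false, false, true] + ratom ends side v a₂ a₃ o p ![true, false, false, false, false, false] + ratom ends side v a₂ a₃ o p ![false, true, true, false, false, true] + ratom ends side v a₂ a₃ o p ![false, true, false, false, true, false] + ratom ends side v a₂ a₃ o p ![false, true, false, false, false, false] + ratom ends side v a₂ a₃ o p ![false, false, true, true, false, false] + ratom ends side v a₂ a₃ o p ![false, false, true, false, false, false] + ratom ends side v a₂ a₃ o p ![false, false, false, true, true, true] + ratom ends side v a₂ a₃ o p ![false, false, false, true, false, false] + ratom ends side v a₂ a₃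 o p ![false, false, false, false, true, false] + ratom ends side v a₂ a₃ o p ![false, false, false, false, false, true]) := by
      linear_combination hr
    rw [e_bx h p h2 (a₃ := a₃) (o := o),
    e_Dpo h p h2 h3 ho (a₃ := a₃) (o := o),
    e_nx3 h p h2 h3 (a₃ := a₃) (o := o),
    e_Dp h p h2 h3 (a₃ := a₃) (o := o),
    e_alpha h p h2 h3 ho (a₃ := a₃) (o := o),
    e_beta h p h2 h3 ho (a₃ := a₃) (o := o),
    e_oL3nU h p h2 h3 ho (a₃ := a₃) (o := o),
    e_3L h p h2 h3 (a₃ := a₃) (o := o),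
    cx_X1 h p h2 h3 ho (a₃ := a₃) (o := o),
    cx_A h p h2 h3 (a₃ := a₃) (o := o),
    cx_X2 h p h2 h3 ho (a₃ := a₃) (o := o),
    cx_X3 h p h2 h3 (a₃ := a₃) (o := o), hrs]
    ring
  rw [hid]
  have hbx := prob_nonneg hp {ω : Config E | Conn ends ω v a₂}
  have h1' := prob_nonneg hp {ω : Config E | ¬ Conn ends ω v a₂ ∧ Conn ends ω o v ∧ ¬ (Conn ends ω a₃ v ∨ Conn ends ω a₃ a₂)}
  have h2' := prob_nonneg hp {ω : Config E | ¬ Conn ends ω v a₂ ∧ Conn ends ω a₃ v}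
  have h3' := prob_nonneg hp {ω : Config E | ¬ Conn ends ω v a₂ ∧ ¬ (Conn ends ω a₃ v ∨ Conn ends ω a₃ a₂)}
  have h4' := prob_nonneg hp {ω : Config E | ¬ Conn ends ω v a₂ ∧ Conn ends ω o v ∧ Conn ends ω a₃ a₂}
  have h6 : (0 : R) ≤ 2 := by norm_num
  exact mul_nonneg (mul_nonneg h6 hbx) (add_nonneg (add_nonneg (add_nonneg (mul_nonneg h1' h2')
    (mul_nonneg h3' h1')) (mul_nonneg h3' h4')) (sub_nonneg.2 hX))

/-- The identities `X₂ = n₃ₒ − P(oH, vH, 3∉H)`, `A = n₃ − P(vH, 3∉H)`, `X₃ = P(Q′, 3L)`, `X₁ = P(Q′, oH, 3L)`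
in the atoms. -/
theorem rb_atom_ids [DecidableEq V] (h2 : a₂ ∈ Rt ∨ a₂ = v) (h3 : a₃ ∈ Rt ∨ a₃ = v)
    (ho : o ∈ Rt ∨ o = v) :
    prob p (clusterInEvent ends a₂ {W : Set V | o ∈ W} ∩ avoidAll ends a₂ {v, a₃}) = prob p {ω | Conn ends ω o a₂ ∧ ¬ Conn ends ω a₃ a₂} - prob p {ω | Conn ends ω o a₂ ∧ Conn ends ω v a₂ ∧ ¬ Conn ends ω a₃ a₂} ∧ prob p (avoidAll ends a₂ {v, a₃}) = prob p {ω | ¬ Conn ends ω a₃ a₂} - prob p {ω | Conn ends ω v a₂ ∧ ¬ Conn ends ω a₃ a₂} ∧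
      prob p (clusterInEvent ends v {W : Set V | a₃ ∈ W} ∩ avoidAll ends a₂ {v, a₃}) = prob p {ω | ¬ Conn ends ω v a₂ ∧ Conn ends ω a₃ v} ∧ prob p (clusterInEvent ends a₂ {W : Set V | o ∈ W} ∩ clusterInEvent ends v {W : Set V | a₃ ∈ W} ∩ avoidAll ends a₂ {v, a₃}) = prob p {ω | ¬ Conn ends ω v a₂ ∧ Conn ends ω o a₂ ∧ Conn ends ω a₃ v} := by
  have hr := ratom_sum_transSix ends side v a₂ a₃ o p
  rw [sum_transSix] at hr
  have hrs : ratom ends side v a₂ a₃ o p ![false, false, false, false, false, false] = 1 - (ratom ends side v a₂ a₃ o p ![true, true, true, true, true, true] + ratom ends side v a₂ a₃ o p ![true, true, false, true, false, false] + ratom ends side v a₂ a₃ o p ![true, false, true, false, true, false] + ratom ends side v a₂ a₃ o p ![true, false, false, false, false, true] + ratom ends side v a₂ a₃ o p ![true, false, false, false, false, false] + ratom ends side v a₂ a₃ o p ![false, true, true, false, false, true] + ratom ends side v a₂ a₃ o p ![false, true, false, false, true, false] + ratom ends side v a₂ a₃ o p ![false, true, false, false, false, false] + ratom ends side v a₂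 a₃ o p ![false, false, true, true, false, false] + ratom ends side v a₂ a₃ o p ![false, false, true, false, false, false] + ratom ends side v a₂ a₃ o p ![false, false, false, true, true, true] + ratom ends side v a₂ a₃ o p ![false, false, false, true, false, false] + ratom ends side v a₂ a₃ o p ![false, false, false, false, true, false] + ratom ends side v a₂ a₃ o p ![false, false, false, false, false, true]) := by
    linear_combination hr
  rw [cx_X2 h p h2 h3 ho (a₃ := a₃) (o := o), cx_A h p h2 h3 (a₃ := a₃) (o := o),
    cx_X3 h p h2 h3 (a₃ := a₃) (o := o), cx_X1 h p h2 h3 ho (a₃ := a₃) (o := o),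
    sc_ox3 h p h2 h3 ho (a₃ := a₃) (o := o), sc_x3 h p h2 h3 (a₃ := a₃) (o := o),
    e_n3o h p h2 h3 ho (a₃ := a₃) (o := o), e_n3 h p h2 h3 (a₃ := a₃) (o := o), e_3L h p h2 h3 (a₃ := a₃) (o := o), e_oH3L h p h2 h3 ho (a₃ := a₃) (o := o), hrs]
  refine ⟨by ring, by ring, by ring, by ring⟩

/-- **`n₃ X₁ ≤ n₃ₒ X₃`**: the two BHK steps and the division by `A`. -/
theorem key_rb [Fintype V] [DecidableEq V] [LinearOrder R] [IsStrictOrderedRing R]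
    (h2 : a₂ ∈ Rt ∨ a₂ = v) (h3 : a₃ ∈ Rt ∨ a₃ = v) (ho : o ∈ Rt ∨ o = v) (hp : IsProbVec p) :
    prob p {ω | ¬ Conn ends ω a₃ a₂} * prob p {ω | ¬ Conn ends ω v a₂ ∧ Conn ends ω o a₂ ∧ Conn ends ω a₃ v} ≤ prob p {ω | Conn ends ω o a₂ ∧ ¬ Conn ends ω a₃ a₂} * prob p {ω | ¬ Conn ends ω v a₂ ∧ Conn ends ω a₃ v} := by
  have hX := cross_avoid p hp (ends := ends) (v := v) (a₂ := a₂) (a₃ := a₃) (o := o)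
  have hS := bhk_o_v_avoid3 ends v a₂ a₃ o hp
  obtain ⟨eX2, eA, eX3, eX1⟩ := rb_atom_ids h p h2 h3 ho
  rw [← eX3, ← eX1]
  have hn3 := prob_nonneg hp {ω : Config E | ¬ Conn ends ω a₃ a₂}
  have hX3 := prob_nonneg hp (clusterInEvent ends v {W : Set V | a₃ ∈ W} ∩ avoidAll ends a₂ {v, a₃})
  have hX1 := prob_nonneg hp (clusterInEvent ends a₂ {W : Set V | o ∈ W} ∩ clusterInEvent ends v {W : Set V | a₃ ∈ W} ∩ avoidAll ends a₂ {v, a₃})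
  have hA := prob_nonneg hp (avoidAll ends a₂ {v, a₃})
  have hX1A : prob p (clusterInEvent ends a₂ {W : Set V | o ∈ W} ∩ clusterInEvent ends v {W : Set V | a₃ ∈ W} ∩ avoidAll ends a₂ {v, a₃}) ≤ prob p (avoidAll ends a₂ {v, a₃}) := prob_mono hp Set.inter_subset_right
  have hX3A : prob p (clusterInEvent ends v {W : Set V | a₃ ∈ W} ∩ avoidAll ends a₂ {v, a₃}) ≤ prob p (avoidAll ends a₂ {v, a₃}) := prob_mono hp Set.inter_subset_right
  have s2 : prob p {ω | ¬ Conn ends ω a₃ a₂} * prob p (clusterInEvent ends a₂ {W : Set V | o ∈ W} ∩ avoidAll ends a₂ {v, a₃}) ≤ prob p {ω | Conn ends ω o a₂ ∧ ¬ Conn ends ω a₃ a₂} * prob p (avoidAll ends a₂ {v, a₃}) := by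
    rw [eX2, eA]
    nlinarith [hS]
  have s3 : prob p {ω | ¬ Conn ends ω a₃ a₂} * prob p (clusterInEvent ends a₂ {W : Set V | o ∈ W} ∩ clusterInEvent ends v {W : Set V | a₃ ∈ W} ∩ avoidAll ends a₂ {v, a₃}) * prob p (avoidAll ends a₂ {v, a₃}) ≤ prob p {ω | Conn ends ω o a₂ ∧ ¬ Conn ends ω a₃ a₂} * prob p (clusterInEvent ends v {W : Set V | a₃ ∈ W} ∩ avoidAll ends a₂ {v, a₃}) * prob p (avoidAll ends a₂ {v, a₃}) := by
    nlinarith [mul_le_mul_of_nonneg_left hX hn3, mul_le_mul_of_nonneg_right s2 hX3]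
  rcases hA.lt_or_eq with hpos | hzero
  · exact le_of_mul_le_mul_right s3 hpos
  · have e1 : prob p (clusterInEvent ends a₂ {W : Set V | o ∈ W} ∩ clusterInEvent ends v {W : Set V | a₃ ∈ W} ∩ avoidAll ends a₂ {v, a₃}) = 0 := le_antisymm (hzero ▸ hX1A) hX1
    have e3 : prob p (clusterInEvent ends v {W : Set V | a₃ ∈ W} ∩ avoidAll ends a₂ {v, a₃}) = 0 := le_antisymm (hzero ▸ hX3A) hX3
    rw [e1, e3, mul_zero, mul_zero]

/-- **`h(0) ≥ 0`** for the T7 reduction. -/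
theorem h0_rb_nonneg [Fintype V] [DecidableEq V] [LinearOrder R] [IsStrictOrderedRing R]
    (h2 : a₂ ∈ Rt ∨ a₂ = v) (h3 : a₃ ∈ Rt ∨ a₃ = v) (ho : o ∈ Rt ∨ o = v) (hp : IsProbVec p) :
    0 ≤ 2 * prob p {ω | Conn ends ω v a₂} * (prob p {ω | ¬ Conn ends ω a₃ a₂} * (prob p {ω | ¬ Conn ends ω v a₂ ∧ Conn ends ω o v ∧ ¬ (Conn ends ω a₃ v ∨ Conn ends ω a₃ a₂)} + prob p {ω | ¬ Conn ends ω v a₂ ∧ Conn ends ω o v ∧ Conn ends ω a₃ a₂}) + prob p {ω | Conn ends ω o a₂ ∧ ¬ Conn ends ω a₃ a₂} * prob p {ω | ¬ Conn ends ω v a₂ ∧ Conn ends ω a₃ v} - prob p {ω | ¬ Conn ends ω a₃ a₂} * prob p {ω | ¬ Conn ends ω v a₂ ∧ Conn ends ω o a₂ ∧ Conn ends ω a₃ v}) := by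
  have key := key_rb h p h2 h3 ho hp
  have hbx := prob_nonneg hp {ω : Config E | Conn ends ω v a₂}
  have hn3 := prob_nonneg hp {ω : Config E | ¬ Conn ends ω a₃ a₂}
  have h1' := prob_nonneg hp {ω : Config E | ¬ Conn ends ω v a₂ ∧ Conn ends ω o v ∧ ¬ (Conn ends ω a₃ v ∨ Conn ends ω a₃ a₂)}
  have h4' := prob_nonneg hp {ω : Config E | ¬ Conn ends ω v a₂ ∧ Conn ends ω o v ∧ Conn ends ω a₃ a₂}
  have h6 : (0 : R) ≤ 2 := by norm_num
  have : 0 ≤ prob p {ω | ¬ Conn ends ω a₃ a₂} * (prob p {ω | ¬ Conn ends ω v a₂ ∧ Conn ends ω o v ∧ ¬ (Conn ends ω a₃ v ∨ Conn ends ω a₃ a₂)} + prob p {ω | ¬ Conn ends ω v a₂ ∧ Conn ends ω o v ∧ Conn ends ω a₃ a₂}) + prob p {ω | Conn ends ω o a₂ ∧ ¬ Conn ends ω a₃ a₂} * prob p {ω | ¬ Conn ends ω v a₂ ∧ Conn ends ω a₃ v} - prob p {ω | ¬ Conn ends ω a₃ a₂} * prob p {ω | ¬ Conn ends ω v a₂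 ∧ Conn ends ω o a₂ ∧ Conn ends ω a₃ v} := by
    nlinarith [mul_nonneg hn3 (add_nonneg h1' h4')]
  exact mul_nonneg (mul_nonneg h6 hbx) this

/-- **(HCOV) with a root and `b` behind a cut vertex** — the sixth two-far-mark class of S3.5 in
the kernel, unconditionally, every admissible weight vector. -/
theorem HCov_a1bFar [Fintype V] [DecidableEq V] [LinearOrder R] [IsStrictOrderedRing R]
    (h1 : a₁ ∈ L ∨ a₁ = v) (hb : b ∈ L ∨ b = v) (h2 : a₂ ∈ Rt ∨ a₂ = v) (h3 : a₃ ∈ Rt ∨ a₃ = v)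
    (ho : o ∈ Rt ∨ o = v) (hp : IsProbVec p) : HCov p ends o a₁ a₂ a₃ b :=
  HCov_a1bFar_of_two h p h1 hb h2 h3 ho hp (h0_rb_nonneg h p h2 h3 ho hp)
    (h1_rb_nonneg h p h2 h3 ho hp)

end RBClass

end CutTwoFar

end Summit.Ventures.PercRepro2
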